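import Literature.AlgebraicGeometry.Morphisms.CechModuleH2ScalingVanishing
import Literature.AlgebraicGeometry.Morphisms.CechModuleH2RefinementMap
import Literature.AlgebraicGeometry.Morphisms.CechModuleUnit
import Literature.AlgebraicGeometry.Modules.SheafHomFunctor
import Mathlib.Algebra.Category.ModuleCat.Sheaf.Free
import HarnessLib

/-!
# Čech `2`-cochains of a module with a finite global frame, in FRAME COORDINATES
# (The Stacks Project, Tag 01ED; Görtz–Wedhorn II Def. 21.71; Oort 1971 §2.2 «componentwise»)

Layer `Literature/AlgebraicGeometry/Morphisms`; namespace `Literature.AlgebraicGeometry.Morphisms`.  DEFINITION file (four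
definitions of DATA from a frame — the coordinate projections `freeProj` of `𝒪_X^I`, the projections `frameProj`, the inclusions `frameIncl`,
the frame vectors `frameVec` — one reducible abbreviation `coordC2`, and theorems; no instance, no notation, no named fact, no `sorry`).  Companion of ★ `Morphisms/CechModuleH2Biproduct`
(the CLASS-level frame equivalence `Ȟ²(𝒰, E) ≃ₗ (I → Ȟ²(𝒰, 𝒪_X))`) and ★ `Morphisms/CechModuleH2ScalingVanishing` §2 (componentwise
coboundary criterion for a frame of MAPS `π_a`, `σ_a` with `∑ π_a ≫ σ_a = 𝟙`): here the frame is a GLOBAL FRAME OF SECTIONS.  For an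
`A`-scheme `f : X → Spec A`, an `𝒪_X`-module `E` with `e : E ≅ 𝒪_X^I = SheafOfModules.free I` (`I` finite) and a family of opens `𝒰`:

* §1 `freeProj j : 𝒪_X^I ⟶ 𝒪_X` (the coordinate projections of `SheafOfModules.free I`, descended from the cofan `ιFree`, Mathlib
  `SheafOfModules.isColimitFreeCofan`), `frameProj e j : E ⟶ 𝒪_X`, `frameIncl e j : 𝒪_X ⟶ E`, **`sum_frameProj_comp_frameIncl : ∑ⱼ πⱼ ≫ ιⱼ = 𝟙`**,
  `frameIncl_comp_frameProj_self ∕ _ne : ιᵢ ≫ πⱼ = δᵢⱼ`; the frame vectors `frameVec e j := ιⱼ(1) ∈ Γ(X, E)`;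
* §2 sections in coordinates: `app_frameIncl_eq_smul` (`ιⱼ(r) = r • Θⱼ|`), **`eq_sum_frameProj_smul_frameVec`** (every section
  `m ∈ Γ(W, E)` is `∑ⱼ πⱼ(m) • Θⱼ|_W`), `frameProj_frameVec_self ∕ _ne` (`πⱼ(Θᵢ|_W) = δᵢⱼ`), **`eq_of_eq_sum_smul_frameVec`** (coordinates are unique);
* §3 `coordC2 e U j := cechMapC2 f (frameProj e j) U` — the `j`-th FRAME COORDINATE of a Čech `2`-cochain — with the DECOMPOSITION letter
  **`cechMC2_eq_sum_coordC2_smul_frameVec : c a b d = ∑ⱼ (coordC2 e U j c a b d) • Θⱼ|`**, UNIQUENESS `coordC2_eq_of_eq_sum`, cocycles ∕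
  coboundaries (`coordC2_mem_cechMZ2 ∕ _cechMB2`), linearity in the morphism is Mathlib's;
* §4 CLASSES BY COORDINATES on one family: **`CechMH2.mk_eq_smul_mk_of_coordC2`** (`(∀ j, [πⱼ z′] = n • [πⱼ z]) → [z′] = n • [z]`, via ★
  `mem_cechMB2_of_components`), `CechMH2.mk_eq_zero_of_coordC2`, `CechMH2.mk_eq_mk_of_coordC2`;
* §5 REFINEMENT: `coordC2_refineC2` (coordinates commute with ★ `cechMRefineC2`, = ★ `cechMapC2_refineC2`).

Consumed by the (U-ab) assembler (O6) at `E := 𝒯_{X_κ}` (frame ★ `nonempty_tangentSheaf_iso_free_of_isLocalRing`, `I := Fin g`).  Cell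
`hodgecm-mathlib` (D-0151), FLOOR 0 ∕ P6 (U)-road brick (S4) (WANTED B-p04 (g50) 21:54:46Z (W1)–(W3)); generic, count-neutral — HC_CM is proved only
modulo the 7 printed citations until rung 0 closes, and nothing here refers to it.

## References
* The Stacks Project, Tag 01ED (Cohomology, Section 20.9: the Čech complex is functorial — additive — in the sheaf). [StacksProject]
* U. Görtz, T. Wedhorn, *Algebraic Geometry II* (2023), (21.16) Def. 21.71 (p. 181). [GortzWedhorn2023]
* F. Oort, *Finite group schemes, local moduli for abelian varieties, and lifting problems*, Compositio Math. 23 (1971), §2.2 (pp. 277–280)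
  (obstruction classes in `H²(X₀, Θ) ⊗ J = H²(X₀, 𝒪) ⊗ 𝔱 ⊗ J` read componentwise on a frame of `Θ`). [Oort1971]
-/

noncomputable section

open CategoryTheory AlgebraicGeometry Limits TopologicalSpace Opposite
open Literature.AlgebraicGeometry.Modules (unitModule)

universe u v w

namespace Literature.AlgebraicGeometry.Morphisms

set_option backward.isDefEq.respectTransparency false

variable {A : Type u} [CommRing A] {X : Scheme.{u}} (f : X ⟶ Spec (.of A))
  {I : Type u} [Fintype I] {E : X.Modules} (e : E ≅ SheafOfModules.free (R := X.ringCatSheaf) I)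

/-! ## §1 The frame maps `πⱼ : E → 𝒪_X`, `ιⱼ : 𝒪_X → E` of a global frame `e : E ≅ 𝒪_X^I` -/

/-- **The `j`-th coordinate projection `𝒪_X^I → 𝒪_X`** of the free module `SheafOfModules.free I = ∐_I 𝒪_X` (descended from the
cofan `ιFree`: identity on the `j`-th summand, zero on the others). [cite: StacksProject, Tag 01ED (Cohomology, Section 20.9)] -/
def freeProj (j : I) : SheafOfModules.free (R := X.ringCatSheaf) I ⟶ unitModule X := by
  classical
  exact Cofan.IsColimit.desc (SheafOfModules.isColimitFreeCofan (R := X.ringCatSheaf) I)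
    (fun i => if i = j then 𝟙 _ else 0)

omit [Fintype I] in
/-- `ιFree j ≫ freeProj j = 𝟙`. [cite: StacksProject, Tag 01ED (Cohomology, Section 20.9)] -/
theorem ιFree_comp_freeProj_self (j : I) :
    SheafOfModules.ιFree (R := X.ringCatSheaf) j ≫ freeProj (X := X) j = 𝟙 _ := by
  classical
  have h := Cofan.IsColimit.fac (SheafOfModules.isColimitFreeCofan (R := X.ringCatSheaf) I)
    (fun i => if i = j then (𝟙 _ : unitModule X ⟶ unitModule X) else 0) j
  rw [SheafOfModules.freeCofan_inj, if_pos rfl] at h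
  exact h

omit [Fintype I] in
/-- `ιFree i ≫ freeProj j = 0` for `i ≠ j`. [cite: StacksProject, Tag 01ED (Cohomology, Section 20.9)] -/
theorem ιFree_comp_freeProj_ne {i j : I} (hij : i ≠ j) :
    SheafOfModules.ιFree (R := X.ringCatSheaf) i ≫ freeProj (X := X) j = 0 := by
  classical
  have h := Cofan.IsColimit.fac (SheafOfModules.isColimitFreeCofan (R := X.ringCatSheaf) I)
    (fun i => if i = j then (𝟙 _ : unitModule X ⟶ unitModule X) else 0) i
  rw [SheafOfModules.freeCofan_inj, if_neg hij] at h
  exact h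

/-- **`∑ⱼ freeProj j ≫ ιFree j = 𝟙`** on `𝒪_X^I` (checked on the cofan `ιFree`). [cite: StacksProject, Tag 01ED (Cohomology, Section 20.9)] -/
theorem sum_freeProj_comp_ιFree :
    ∑ j, freeProj (X := X) j ≫ SheafOfModules.ιFree (R := X.ringCatSheaf) j = 𝟙 (SheafOfModules.free (R := X.ringCatSheaf) I) := by
  classical
  refine Cofan.IsColimit.hom_ext (SheafOfModules.isColimitFreeCofan (R := X.ringCatSheaf) I) _ _ fun i => ?_
  rw [SheafOfModules.freeCofan_inj, Preadditive.comp_sum,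
    Finset.sum_eq_single i (fun j _ hji => by rw [← Category.assoc, ιFree_comp_freeProj_ne (Ne.symm hji), zero_comp])
      (fun hi => absurd (Finset.mem_univ i) hi),
    ← Category.assoc, ιFree_comp_freeProj_self]
  exact (Category.comp_id _).symm

/-- **The `j`-th frame PROJECTION `πⱼ : E → 𝒪_X`** of a global frame `e : E ≅ 𝒪_X^I`. [cite: StacksProject, Tag 01ED (Cohomology, Section 20.9)] -/
def frameProj (j : I) : E ⟶ unitModule X := e.hom ≫ freeProj j

/-- **The `j`-th frame INCLUSION `ιⱼ : 𝒪_X → E`**: `SheafOfModules.ιFree j` followed by `e⁻¹`. [cite: StacksProject, Tag 01ED (Cohomology, Section 20.9)] -/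
def frameIncl (j : I) : unitModule X ⟶ E := SheafOfModules.ιFree (R := X.ringCatSheaf) j ≫ e.inv

/-- **`∑ⱼ πⱼ ≫ ιⱼ = 𝟙_E`.** [cite: StacksProject, Tag 01ED (Cohomology, Section 20.9)] -/
theorem sum_frameProj_comp_frameIncl : ∑ j, frameProj e j ≫ frameIncl e j = 𝟙 E := by
  have h : ∀ j, frameProj e j ≫ frameIncl e j =
      e.hom ≫ (freeProj (X := X) j ≫ SheafOfModules.ιFree (R := X.ringCatSheaf) j) ≫ e.inv := fun j => by
    rw [frameProj, frameIncl, Category.assoc, Category.assoc]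
  rw [Finset.sum_congr rfl fun j _ => h j, ← Preadditive.comp_sum, ← Preadditive.sum_comp, sum_freeProj_comp_ιFree]
  exact (congrArg (e.hom ≫ ·) (Category.id_comp e.inv)).trans e.hom_inv_id

omit [Fintype I] in
/-- `ιⱼ ≫ πⱼ = 𝟙`. [cite: StacksProject, Tag 01ED (Cohomology, Section 20.9)] -/
theorem frameIncl_comp_frameProj_self (j : I) : frameIncl e j ≫ frameProj e j = 𝟙 _ := by
  simp only [frameIncl, frameProj, Category.assoc, Iso.inv_hom_id_assoc]
  exact ιFree_comp_freeProj_self j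

omit [Fintype I] in
/-- `ιᵢ ≫ πⱼ = 0` for `i ≠ j`. [cite: StacksProject, Tag 01ED (Cohomology, Section 20.9)] -/
theorem frameIncl_comp_frameProj_ne {i j : I} (hij : i ≠ j) : frameIncl e i ≫ frameProj e j = 0 := by
  simp only [frameIncl, frameProj, Category.assoc, Iso.inv_hom_id_assoc]
  exact ιFree_comp_freeProj_ne hij

/-- **The `j`-th FRAME VECTOR `Θⱼ := ιⱼ(1) ∈ Γ(X, E)`** (a global section of `E`). [cite: StacksProject, Tag 01ED (Cohomology, Section 20.9)] -/
def frameVec (j : I) : MSections f E ⊤ :=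
  MSections.app f (frameIncl e j) ⊤ (show MSections f (unitModule X) ⊤ from (1 : Sections f ⊤))

/-! ## §2 Sections in frame coordinates -/

section SectionsCoord

variable (W : X.Opens)

omit [Fintype I] in
/-- `app` of a finite sum of morphisms is the sum (the sections functor is additive). [cite: StacksProject, Tag 01ED (Cohomology, Section 20.9)] -/
theorem MSections.app_sum' {M N : X.Modules} {J : Type w} (s : Finset J) (φ : J → (M ⟶ N)) (m : MSections f M W) :
    MSections.app f (∑ a ∈ s, φ a) W m = ∑ a ∈ s, MSections.app f (φ a) W m := by
  classical
  induction s using Finset.induction_on with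
  | empty =>
    rw [Finset.sum_empty, Finset.sum_empty, MSections.app_apply, Scheme.Modules.Hom.zero_app]
    rfl
  | insert a s ha ih =>
    rw [Finset.sum_insert ha, Finset.sum_insert ha, MSections.app_apply, Scheme.Modules.Hom.add_app, ← ih]
    rfl

omit [Fintype I] in
/-- The unit section restricts to the unit section (restriction is a ring map). [cite: StacksProject, Tag 01ED (Cohomology, Section 20.9)] -/
theorem res_unit_one {V W : X.Opens} (h : W ≤ V) :
    MSections.res f (unitModule X) h (show MSections f (unitModule X) V from (1 : Sections f V)) =
      (show MSections f (unitModule X) W from (1 : Sections f W)) :=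
  map_one (Sections.res f h)

omit [Fintype I] in
/-- **`φ(r) = r • φ(1)`** for a morphism `φ : 𝒪_X → E` and a section `r ∈ Γ(W, 𝒪_X)` (`φ` is `Γ(W, 𝒪_X)`-linear).
[cite: StacksProject, Tag 01ED (Cohomology, Section 20.9)] -/
theorem app_unit_eq_smul (φ : unitModule X ⟶ E) (r : MSections f (unitModule X) W) :
    MSections.app f φ W r = (show Sections f W from r) •
      MSections.app f φ W (show MSections f (unitModule X) W from (1 : Sections f W)) := by
  rw [← MSections.app_smul]
  congr 1
  exact (mul_one (show Sections f W from r)).symm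

omit [Fintype I] in
/-- `ιⱼ(r) = r • Θⱼ|_W` on an open `W`. [cite: StacksProject, Tag 01ED (Cohomology, Section 20.9)] -/
theorem app_frameIncl_eq_smul (j : I) (r : MSections f (unitModule X) W) :
    MSections.app f (frameIncl e j) W r = (show Sections f W from r) • MSections.res f E (le_top : W ≤ ⊤) (frameVec f e j) := by
  rw [app_unit_eq_smul f W (frameIncl e j) r, frameVec, MSections.res_app, res_unit_one]

/-- **Every section is its coordinates times the frame**: `m = ∑ⱼ πⱼ(m) • Θⱼ|_W` for `m ∈ Γ(W, E)`.
[cite: StacksProject, Tag 01ED (Cohomology, Section 20.9)] -/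
theorem eq_sum_frameProj_smul_frameVec (m : MSections f E W) :
    m = ∑ j, (show Sections f W from MSections.app f (frameProj e j) W m) • MSections.res f E (le_top : W ≤ ⊤) (frameVec f e j) := by
  have h1 : m = MSections.app f (∑ j, frameProj e j ≫ frameIncl e j) W m := by
    rw [sum_frameProj_comp_frameIncl, MSections.app_id]
  conv_lhs => rw [h1]
  rw [MSections.app_sum']
  refine Finset.sum_congr rfl fun j _ => ?_
  rw [MSections.app_comp, app_frameIncl_eq_smul]

omit [Fintype I] in
/-- `πⱼ(Θⱼ|_W) = 1`. [cite: StacksProject, Tag 01ED (Cohomology, Section 20.9)] -/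
theorem frameProj_frameVec_self (j : I) :
    MSections.app f (frameProj e j) W (MSections.res f E (le_top : W ≤ ⊤) (frameVec f e j)) =
      (show MSections f (unitModule X) W from (1 : Sections f W)) := by
  rw [frameVec, MSections.res_app, res_unit_one, ← MSections.app_comp, frameIncl_comp_frameProj_self, MSections.app_id]

omit [Fintype I] in
/-- `πⱼ(Θᵢ|_W) = 0` for `i ≠ j`. [cite: StacksProject, Tag 01ED (Cohomology, Section 20.9)] -/
theorem frameProj_frameVec_ne {i j : I} (hij : i ≠ j) :
    MSections.app f (frameProj e j) W (MSections.res f E (le_top : W ≤ ⊤) (frameVec f e i)) = 0 := by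
  rw [frameVec, MSections.res_app, res_unit_one, ← MSections.app_comp, frameIncl_comp_frameProj_ne e hij, MSections.app_zero]

/-- **Coordinates are unique**: if `m = ∑ⱼ dⱼ • Θⱼ|_W` then `πⱼ(m) = dⱼ` for every `j`. [cite: StacksProject, Tag 01ED (Cohomology, Section 20.9)] -/
theorem eq_of_eq_sum_smul_frameVec (m : MSections f E W) (d : I → Sections f W)
    (hm : m = ∑ j, d j • MSections.res f E (le_top : W ≤ ⊤) (frameVec f e j)) (i : I) :
    MSections.app f (frameProj e i) W m = (show MSections f (unitModule X) W from d i) := by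
  rw [hm, map_sum, Finset.sum_eq_single i (fun j _ hji => by rw [MSections.app_smul, frameProj_frameVec_ne f e W hji, smul_zero])
    (fun hi => absurd (Finset.mem_univ i) hi), MSections.app_smul, frameProj_frameVec_self]
  exact mul_one (d i)

end SectionsCoord

/-! ## §3 Frame coordinates of Čech `2`-cochains -/

section Cochains

variable {ι : Type v} (U : ι → X.Opens)

/-- **The `j`-th frame coordinate of a Čech `2`-cochain of `E`**: `(πⱼ)_*` on cochains (★ `cechMapC2`), an `A`-linear map
`Č²(𝒰, E) → Č²(𝒰, 𝒪_X)`. [cite: StacksProject, Tag 01ED (Cohomology, Section 20.9)] [cite: GortzWedhorn2023, (21.16) Def. 21.71 (p. 181)] -/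
abbrev coordC2 (j : I) : CechMC2 f E U →ₗ[A] CechMC2 f (unitModule X) U := cechMapC2 f (frameProj e j) U

/-- **DECOMPOSITION of a `2`-cochain along the frame**: `c_{abd} = ∑ⱼ (coordC2 e j c)_{abd} • Θⱼ|_{U_{abd}}`.
[cite: StacksProject, Tag 01ED (Cohomology, Section 20.9)] [cite: Oort1971, §2.2 (pp. 277–280)] -/
theorem cechMC2_eq_sum_coordC2_smul_frameVec (c : CechMC2 f E U) (a b d : ι) :
    c a b d = ∑ j, (show Sections f (U a ⊓ U b ⊓ U d) from coordC2 f e U j c a b d) •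
      MSections.res f E (le_top : U a ⊓ U b ⊓ U d ≤ ⊤) (frameVec f e j) :=
  eq_sum_frameProj_smul_frameVec f e (U a ⊓ U b ⊓ U d) (c a b d)

/-- **UNIQUENESS of the coordinates**: if `c_{abd} = ∑ⱼ (dⱼ)_{abd} • Θⱼ|` for all `a b d`, then `coordC2 e j c = dⱼ` for every `j`.
[cite: StacksProject, Tag 01ED (Cohomology, Section 20.9)] -/
theorem coordC2_eq_of_eq_sum (c : CechMC2 f E U) (d : I → CechMC2 f (unitModule X) U)
    (hc : ∀ a b d', c a b d' = ∑ j, (show Sections f (U a ⊓ U b ⊓ U d') from d j a b d') •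
      MSections.res f E (le_top : U a ⊓ U b ⊓ U d' ≤ ⊤) (frameVec f e j)) (j : I) :
    coordC2 f e U j c = d j := by
  funext a b d'
  rw [cechMapC2_apply]
  exact eq_of_eq_sum_smul_frameVec f e (U a ⊓ U b ⊓ U d') (c a b d') (fun j => d j a b d') (hc a b d') j

omit [Fintype I] in
/-- Coordinates of a `2`-cocycle are `2`-cocycles. [cite: StacksProject, Tag 01ED (Cohomology, Section 20.9)] -/
theorem coordC2_mem_cechMZ2 (j : I) {c : CechMC2 f E U} (hc : c ∈ cechMZ2 f E U) :
    coordC2 f e U j c ∈ cechMZ2 f (unitModule X) U :=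
  mapC2_mem_cechMZ2 f (frameProj e j) U hc

omit [Fintype I] in
/-- Coordinates of a `2`-coboundary are `2`-coboundaries. [cite: StacksProject, Tag 01ED (Cohomology, Section 20.9)] -/
theorem coordC2_mem_cechMB2 (j : I) {c : CechMC2 f E U} (hc : c ∈ cechMB2 f E U) :
    coordC2 f e U j c ∈ cechMB2 f (unitModule X) U :=
  mapC2_mem_cechMB2 f (frameProj e j) U hc

/-- **A cochain all of whose coordinates are coboundaries is a coboundary** (★ `mem_cechMB2_of_components` for the frame
`∑ⱼ πⱼ ≫ ιⱼ = 𝟙`). [cite: StacksProject, Tag 01ED (Cohomology, Section 20.9)] [cite: Oort1971, §2.2 (pp. 277–280)] -/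
theorem mem_cechMB2_of_coordC2 {c : CechMC2 f E U} (hc : ∀ j, coordC2 f e U j c ∈ cechMB2 f (unitModule X) U) :
    c ∈ cechMB2 f E U :=
  mem_cechMB2_of_components f U (frameProj e) (frameIncl e) (sum_frameProj_comp_frameIncl e) hc

/-! ## §4 Classes by coordinates (one family of opens) -/

/-- **CLASSES BY COORDINATES**: for `2`-cocycles `z`, `z′` of `E` and `n : A`, if `[πⱼ z′] = n • [πⱼ z]` in `Ȟ²(𝒰, 𝒪_X)` for every
`j`, then `[z′] = n • [z]` in `Ȟ²(𝒰, E)`. [cite: StacksProject, Tag 01ED (Cohomology, Section 20.9)] [cite: Oort1971, §2.2 (pp. 277–280)] -/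
theorem CechMH2.mk_eq_smul_mk_of_coordC2 (z z' : cechMZ2 f E U) (n : A)
    (h : ∀ j, CechMH2.mk f (unitModule X) U ⟨coordC2 f e U j z', coordC2_mem_cechMZ2 f e U j z'.2⟩ =
      n • CechMH2.mk f (unitModule X) U ⟨coordC2 f e U j z, coordC2_mem_cechMZ2 f e U j z.2⟩) :
    CechMH2.mk f E U z' = n • CechMH2.mk f E U z := by
  rw [← sub_eq_zero, ← map_smul, ← map_sub, CechMH2.mk_eq_zero_iff]
  refine mem_cechMB2_of_coordC2 f e U fun j => ?_
  have hj := h j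
  rw [← map_smul, CechMH2.mk_eq_mk_iff] at hj
  have e1 : coordC2 f e U j ((z' - n • z : cechMZ2 f E U) : CechMC2 f E U) =
      coordC2 f e U j z' - n • coordC2 f e U j z := by
    rw [Submodule.coe_sub, Submodule.coe_smul, map_sub, map_smul]
  rw [e1]
  exact hj

/-- **`[z] = 0` if every coordinate class `[πⱼ z]` vanishes.** [cite: StacksProject, Tag 01ED (Cohomology, Section 20.9)] -/
theorem CechMH2.mk_eq_zero_of_coordC2 (z : cechMZ2 f E U)
    (h : ∀ j, CechMH2.mk f (unitModule X) U ⟨coordC2 f e U j z, coordC2_mem_cechMZ2 f e U j z.2⟩ = 0) :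
    CechMH2.mk f E U z = 0 := by
  rw [CechMH2.mk_eq_zero_iff]
  exact mem_cechMB2_of_coordC2 f e U fun j => (CechMH2.mk_eq_zero_iff _ _ _ _).mp (h j)

/-- **`[z′] = [z]` if the coordinate classes agree.** [cite: StacksProject, Tag 01ED (Cohomology, Section 20.9)] -/
theorem CechMH2.mk_eq_mk_of_coordC2 (z z' : cechMZ2 f E U)
    (h : ∀ j, CechMH2.mk f (unitModule X) U ⟨coordC2 f e U j z', coordC2_mem_cechMZ2 f e U j z'.2⟩ =
      CechMH2.mk f (unitModule X) U ⟨coordC2 f e U j z, coordC2_mem_cechMZ2 f e U j z.2⟩) :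
    CechMH2.mk f E U z' = CechMH2.mk f E U z := by
  have h1 := CechMH2.mk_eq_smul_mk_of_coordC2 f e U z z' 1 (fun j => by rw [one_smul]; exact h j)
  rwa [one_smul] at h1

end Cochains

/-! ## §5 Coordinates commute with refinement -/

section Refine

variable {ι : Type v} {ι' : Type w} (U : ι → X.Opens) (V : ι' → X.Opens) (τ : ι' → ι) (hτ : ∀ s, V s ≤ U (τ s))

omit [Fintype I] in
/-- **Frame coordinates commute with refinement**: `coordC2 (ρ c) = ρ (coordC2 c)` (★ `cechMapC2_refineC2`).
[cite: GortzWedhorn2023, (21.16) Def. 21.71 (p. 181)] [cite: StacksProject, Tag 01ED (Cohomology, Section 20.9)] -/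
theorem coordC2_refineC2 (j : I) (c : CechMC2 f E U) :
    coordC2 f e V j (cechMRefineC2 f E U V τ hτ c) = cechMRefineC2 f (unitModule X) U V τ hτ (coordC2 f e U j c) :=
  cechMapC2_refineC2 f (frameProj e j) U V τ hτ c

end Refine

end Literature.AlgebraicGeometry.Morphisms

end
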